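import Literature.Combinatorics.Sahi2008.MeasureFunctional
import Literature.Combinatorics.Sahi2008.TotalOrder

/-!
# `NoHeavyLowerTail` (crux stmt-CriticalPhenomena-4575), Sahi programme: Sahi's inequalities of EVERY order for EVERY
# probability measure on a totally ordered space (Blinovsky's Lemma 1, continuum form)

Support file (Sahi cell, typer seat, generation 5; `--supports stmt-CriticalPhenomena-4575`).

Blinovsky's Lemma 1 [Blinovsky 2013] (tree: `Literature.Combinatorics.Sahi2008.sahiPositive_of_linearOrder`) says that
every probability WEIGHT on a FINITE chain is Sahi-positive of every order; Lieb–Sahi [LiebSahi2021, Lemma 3.2] add the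
unit interval with Lebesgue measure (tree: `mSahiPositive_volume_unitInterval`).  Here: the same for EVERY
probability MEASURE on EVERY totally ordered measurable space.

**Theorem** (`msahiE_nonneg_of_linearOrder`).  Let `(Ω, ≤)` be a linear order with a σ-algebra and `μ` a probability
measure on it.  For every `n` and all measurable, monotone, nonnegative, bounded `f_0,…,f_{n−1} : Ω → ℝ`:
`E_n(f_0,…,f_{n−1}) ≥ 0` (the measure-level functional `msahiE` of `MeasureFunctional.lean`).  Corollaries: every
probability measure on `[0,1]` (`mSahiPositive_of_probabilityMeasure_unitInterval`) and every probability measure on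
`ℝ` for bounded monotone families (`msahiE_nonneg_of_probabilityMeasure_real`) — measurability and, on `[0,1]`,
boundedness being automatic.  New in this generality (ours); the ingredients in print are Blinovsky's finite lemma and
the definition of `E_n`.

Proof.  RANGE QUANTISATION: `g_i = ⌊k f_i⌋/k` is again monotone, `0 ≤ f_i − g_i ≤ 1/k`, and the vector
`x ↦ (⌊k f_i(x)⌋)_i` takes finitely many values and is monotone from a CHAIN, so its values form a chain; hence
`ψ(x) = Σ_i ⌊k f_i(x)⌋` determines every `⌊k f_i(x)⌋` monotonically: `g_i = θ_i ∘ ψ` with `θ_i` monotone on the finite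
chain `{0,…,N}` (`theta`, `theta_levelSum`).  So `E_n^μ(g) = E_n^w(θ)` for the push-forward weight `w` of `μ` under `ψ`
(`msahiE_nonneg_of_factor`), which is `≥ 0` by Blinovsky's lemma; and `E_n^μ(g^{(k)}) → E_n^μ(f)` by dominated
convergence of the joint moments and the continuity of the moment polynomial (`momentE`).
-/

noncomputable section

namespace Summit.CriticalPhenomena.PercolationContinuityZ3.Theorems.SahiLinearOrderMeasure

open Finset Function MeasureTheory Set Filter Topology
open Literature.Combinatorics.Sahi2008
open scoped unitInterval

variable {Ω : Type*}

/-! ## Functions factoring monotonically through a finite chain -/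

section Factor

variable [MeasurableSpace Ω]

/-- **Discrete core.**  If `ψ : Ω → T` is a measurable map into a finite chain and `θ_i : T → ℝ` are nonnegative
and monotone, then `E_n^μ(θ_0 ∘ ψ,…,θ_{n−1} ∘ ψ) ≥ 0` for every probability measure `μ` on `Ω`: the joint moments
are those of `θ` under the push-forward weight `t ↦ μ(ψ = t)`, a probability weight on a finite chain, to which
Blinovsky's Lemma 1 applies. [this work] -/
theorem msahiE_nonneg_of_factor {T : Type*} [LinearOrder T] [Fintype T] [MeasurableSpace T]
    [MeasurableSingletonClass T] (μ : Measure Ω) [IsProbabilityMeasure μ] {ψ : Ω → T} (hψ : Measurable ψ)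
    {n : ℕ} (θ : Fin n → T → ℝ) (hθ0 : ∀ i t, 0 ≤ θ i t) (hθ : ∀ i, Monotone (θ i)) :
    0 ≤ msahiE μ n (fun i => θ i ∘ ψ) := by
  set w : T → ℝ := fun t => μ.real (ψ ⁻¹' {t}) with hw
  have hw0 : ∀ t, 0 ≤ w t := fun t => measureReal_nonneg
  have hw1 : ∑ t, w t = 1 := by
    rw [hw]
    simp only
    rw [sum_measureReal_preimage_singleton univ (fun t _ => hψ (measurableSet_singleton t)), coe_univ,
      Set.preimage_univ, probReal_univ]
  have hmom : ∀ S : Finset (Fin n), ∫ x, (∏ i ∈ S, (θ i ∘ ψ)) x ∂μ = ex w (∏ i ∈ S, θ i) := by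
    intro S
    have hγ : AEStronglyMeasurable (∏ i ∈ S, θ i) (μ.map ψ) :=
      (measurable_of_countable _).aestronglyMeasurable
    have h1 : (fun x => (∏ i ∈ S, (θ i ∘ ψ)) x) = fun x => (∏ i ∈ S, θ i) (ψ x) := by
      funext x
      simp only [Finset.prod_apply, Function.comp_apply]
    rw [h1, ← integral_map hψ.aemeasurable hγ,
      integral_fintype (Integrable.of_finite (μ := μ.map ψ) (f := ∏ i ∈ S, θ i)), ex]
    refine sum_congr rfl fun t _ => ?_
    rw [map_measureReal_apply hψ (measurableSet_singleton t), smul_eq_mul]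
  rw [msahiE_eq_sahiE_of_moments μ w _ θ hmom]
  exact sahiPositive_of_linearOrder hw0 hw1 n θ hθ0 hθ

end Factor

/-! ## Range quantisation on a chain -/

section Chain

variable {n : ℕ}

/-- The quantised levels `⌊k f_i(x)⌋`. [this work] -/
def level (k : ℕ) (f : Fin n → Ω → ℝ) (i : Fin n) (x : Ω) : ℕ := ⌊(k : ℝ) * f i x⌋₊

/-- The level sum `ψ(x) = Σ_i ⌊k f_i(x)⌋`. [this work] -/
def levelSum (k : ℕ) (f : Fin n → Ω → ℝ) (x : Ω) : ℕ := ∑ i, level k f i x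

/-- Levels are monotone for a monotone family. [this work] -/
theorem level_mono [Preorder Ω] {k : ℕ} {f : Fin n → Ω → ℝ} (hmono : ∀ i, Monotone (f i)) (i : Fin n) :
    Monotone (level k f i) := fun _ _ hxy =>
  Nat.floor_le_floor (mul_le_mul_of_nonneg_left (hmono i hxy) (Nat.cast_nonneg k))

/-- On a chain the level sum determines every level monotonically: `ψ(x) ≤ ψ(y) ⇒ ⌊k f_i(x)⌋ ≤ ⌊k f_i(y)⌋`.
[this work] -/
theorem level_le_of_levelSum_le [LinearOrder Ω] {k : ℕ} {f : Fin n → Ω → ℝ} (hmono : ∀ i, Monotone (f i)) {x y : Ω}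
    (h : levelSum k f x ≤ levelSum k f y) (i : Fin n) : level k f i x ≤ level k f i y := by
  rcases le_total x y with hxy | hyx
  · exact level_mono hmono i hxy
  · -- `y ≤ x`: all levels of `y` are below those of `x`, and the sums agree, so the levels agree
    have hle : ∀ j, level k f j y ≤ level k f j x := fun j => level_mono hmono j hyx
    have hsum : levelSum k f y ≤ levelSum k f x := sum_le_sum fun j _ => hle j
    have heq : levelSum k f x = levelSum k f y := le_antisymm h hsum
    have hall : ∀ j ∈ (univ : Finset (Fin n)), level k f j y = level k f j x :=
      (Finset.sum_eq_sum_iff_of_le fun j _ => hle j).1 heq.symm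
    exact (hall i (mem_univ i)).ge

/-- The monotone functions `θ_i : ℕ → ℝ` on the chain of level sums:
`θ_i(t) = sup {⌊k f_i(x)⌋ / k : ψ(x) ≤ t}` (`0` if no such `x`). [this work] -/
def theta (k : ℕ) (f : Fin n → Ω → ℝ) (i : Fin n) (t : ℕ) : ℝ :=
  sSup ((fun x => (level k f i x : ℝ) / k) '' {x | levelSum k f x ≤ t})

/-- The set of quantised values over `{ψ ≤ t}` is bounded above (by `ψ`'s bound `t`). [this work] -/
theorem bddAbove_theta (k : ℕ) (f : Fin n → Ω → ℝ) (i : Fin n) (t : ℕ) :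
    BddAbove ((fun x => (level k f i x : ℝ) / k) '' {x | levelSum k f x ≤ t}) := by
  refine ⟨(t : ℝ), ?_⟩
  rintro _ ⟨x, hx, rfl⟩
  have h1 : level k f i x ≤ levelSum k f x :=
    Finset.single_le_sum (f := fun j => level k f j x) (fun j _ => Nat.zero_le _) (mem_univ i)
  have h2 : (level k f i x : ℝ) ≤ t := by exact_mod_cast h1.trans hx
  have h3 : (level k f i x : ℝ) / k ≤ (level k f i x : ℝ) := by
    rcases Nat.eq_zero_or_pos k with hk | hk
    · rw [hk, Nat.cast_zero, div_zero]
      positivity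
    · exact div_le_self (Nat.cast_nonneg _) (by exact_mod_cast hk)
  exact h3.trans h2

/-- `θ_i` is nonnegative. [this work] -/
theorem theta_nonneg (k : ℕ) (f : Fin n → Ω → ℝ) (i : Fin n) (t : ℕ) : 0 ≤ theta k f i t := by
  unfold theta
  refine Real.sSup_nonneg ?_
  rintro _ ⟨x, _, rfl⟩
  positivity

/-- `θ_i` is monotone. [this work] -/
theorem theta_mono (k : ℕ) (f : Fin n → Ω → ℝ) (i : Fin n) : Monotone (theta k f i) := by
  intro s t hst
  unfold theta
  by_cases hne : ({x | levelSum k f x ≤ s} : Set Ω).Nonempty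
  · exact csSup_le_csSup (bddAbove_theta k f i t) (hne.image _)
      (Set.image_mono fun x (hx : levelSum k f x ≤ s) => hx.trans hst)
  · rw [Set.not_nonempty_iff_eq_empty] at hne
    rw [hne, Set.image_empty, Real.sSup_empty]
    exact theta_nonneg k f i t

/-- **`g_i = θ_i ∘ ψ`**: on a chain the quantised function factors monotonically through the level sum.
[this work] -/
theorem theta_levelSum [LinearOrder Ω] {k : ℕ} {f : Fin n → Ω → ℝ} (hmono : ∀ i, Monotone (f i)) (i : Fin n) (x : Ω) :
    theta k f i (levelSum k f x) = (level k f i x : ℝ) / k := by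
  unfold theta
  refine le_antisymm ?_ ?_
  · refine csSup_le ⟨_, ⟨x, le_refl (levelSum k f x), rfl⟩⟩ ?_
    rintro _ ⟨y, hy, rfl⟩
    exact div_le_div_of_nonneg_right (by exact_mod_cast level_le_of_levelSum_le hmono hy i) (Nat.cast_nonneg k)
  · exact le_csSup (bddAbove_theta k f i _) ⟨x, le_refl (levelSum k f x), rfl⟩

/-- The quantisation error: `0 ≤ f_i − ⌊k f_i⌋/k ≤ 1/k` (for `f_i ≥ 0`, `k ≥ 1`). [this work] -/
theorem level_div_le {k : ℕ} (hk : 0 < k) {f : Fin n → Ω → ℝ} (hf0 : ∀ i x, 0 ≤ f i x) (i : Fin n) (x : Ω) :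
    (level k f i x : ℝ) / k ≤ f i x ∧ f i x ≤ (level k f i x : ℝ) / k + 1 / k := by
  have hk' : (0 : ℝ) < k := by exact_mod_cast hk
  have hx : (0 : ℝ) ≤ (k : ℝ) * f i x := mul_nonneg hk'.le (hf0 i x)
  have h1 : ((⌊(k : ℝ) * f i x⌋₊ : ℕ) : ℝ) ≤ (k : ℝ) * f i x := Nat.floor_le hx
  have h2 : (k : ℝ) * f i x ≤ ((⌊(k : ℝ) * f i x⌋₊ : ℕ) : ℝ) + 1 := (Nat.lt_floor_add_one _).le
  unfold level
  constructor
  · rw [div_le_iff₀ hk']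
    linarith
  · rw [← add_div, le_div_iff₀ hk']
    linarith

/-- The levels are measurable for a measurable family (plumbing). [this work] -/
theorem measurable_level [MeasurableSpace Ω] {k : ℕ} {f : Fin n → Ω → ℝ} (hfm : ∀ i, Measurable (f i)) (i : Fin n) :
    Measurable (level k f i) :=
  Nat.measurable_floor.comp (measurable_const.mul (hfm i))

/-- The level sum is measurable (plumbing; through the real-valued sum). [this work] -/
theorem measurableSet_levelSum_fibre [MeasurableSpace Ω] {k : ℕ} {f : Fin n → Ω → ℝ} (hfm : ∀ i, Measurable (f i)) (t : ℕ) :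
    MeasurableSet (levelSum k f ⁻¹' {t}) := by
  have h : Measurable fun x => ∑ i, (level k f i x : ℝ) :=
    Finset.measurable_sum _ fun i _ => measurable_from_nat.comp (measurable_level hfm i)
  have hset : levelSum k f ⁻¹' {t} = (fun x => ∑ i, (level k f i x : ℝ)) ⁻¹' {(t : ℝ)} := by
    ext x
    simp only [Set.mem_preimage, Set.mem_singleton_iff, levelSum]
    rw [← Nat.cast_sum, Nat.cast_inj]
  rw [hset]
  exact h (measurableSet_singleton _)

end Chain

/-! ## The theorem -/

/-- **Sahi's inequalities for every probability measure on a totally ordered measurable space.**  If `μ` is a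
probability measure on a linear order `Ω` and `f_0,…,f_{n−1} : Ω → ℝ` are measurable, monotone, nonnegative and
bounded, then `E_n(f_0,…,f_{n−1}) ≥ 0` (Blinovsky's Lemma 1 in the continuum: every chain, every measure, every
order). [this work] -/
theorem msahiE_nonneg_of_linearOrder [MeasurableSpace Ω] [LinearOrder Ω] (μ : Measure Ω) [IsProbabilityMeasure μ] (n : ℕ)
    (f : Fin n → Ω → ℝ) (hfm : ∀ i, Measurable (f i)) (hf0 : ∀ i x, 0 ≤ f i x) {B : ℝ}
    (hfB : ∀ i x, f i x ≤ B) (hmono : ∀ i, Monotone (f i)) : 0 ≤ msahiE μ n f := by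
  classical
  -- the quantised families `g^{(k)}_i = ⌊(k+1) f_i⌋/(k+1)`
  set g : ℕ → Fin n → Ω → ℝ := fun k i x => (level (k + 1) f i x : ℝ) / ((k + 1 : ℕ) : ℝ) with hgdef
  -- Step 1: each `E_n(g^{(k)}) ≥ 0`, by factoring through the finite chain of level sums
  have hpos : ∀ k, 0 ≤ msahiE μ n (g k) := by
    intro k
    set K : ℕ := ⌊((k + 1 : ℕ) : ℝ) * B⌋₊ with hK
    have hlev : ∀ i x, level (k + 1) f i x ≤ K := fun i x =>
      Nat.floor_le_floor (mul_le_mul_of_nonneg_left (hfB i x) (by positivity))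
    have hsum : ∀ x, levelSum (k + 1) f x ≤ n * K := fun x =>
      (sum_le_sum fun i _ => hlev i x).trans (by rw [sum_const, card_univ, Fintype.card_fin, smul_eq_mul])
    let ψ : Ω → Fin (n * K + 1) := fun x => ⟨levelSum (k + 1) f x, Nat.lt_succ_of_le (hsum x)⟩
    have hψ : Measurable ψ := by
      refine measurable_to_countable' fun t => ?_
      have hset : ψ ⁻¹' {t} = levelSum (k + 1) f ⁻¹' {(t : ℕ)} := by
        ext x
        simp only [Set.mem_preimage, Set.mem_singleton_iff, Fin.ext_iff, ψ]
      rw [hset]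
      exact measurableSet_levelSum_fibre hfm _
    have hfac : g k = fun i => (theta (k + 1) f i ∘ Fin.val) ∘ ψ := by
      funext i x
      simp only [Function.comp_apply, ψ, hgdef]
      rw [theta_levelSum hmono]
    rw [hfac]
    exact msahiE_nonneg_of_factor μ hψ (fun i => theta (k + 1) f i ∘ Fin.val)
      (fun i t => theta_nonneg _ _ _ _) fun i a b hab => theta_mono (k + 1) f i (by exact_mod_cast hab)
  -- Step 2: the joint moments of `g^{(k)}` converge to those of `f` (dominated convergence)
  have hgm : ∀ k i, Measurable (g k i) := fun k i =>
    (measurable_from_nat.comp (measurable_level hfm i)).div_const _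
  have hg0 : ∀ k i x, 0 ≤ g k i x := fun k i x => by positivity
  have hgle : ∀ k i x, g k i x ≤ f i x := fun k i x => (level_div_le (Nat.succ_pos k) hf0 i x).1
  have hglim : ∀ i x, Tendsto (fun k => g k i x) atTop (𝓝 (f i x)) := by
    intro i x
    have h0 : Tendsto (fun k : ℕ => f i x - 1 / ((k + 1 : ℕ) : ℝ)) atTop (𝓝 (f i x)) := by
      have h := (tendsto_const_div_atTop_nhds_zero_nat (1 : ℝ)).comp (tendsto_add_atTop_nat 1)
      simpa using (tendsto_const_nhds (x := f i x)).sub h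
    refine tendsto_of_tendsto_of_tendsto_of_le_of_le h0 tendsto_const_nhds (fun k => ?_) fun k => hgle k i x
    have h := (level_div_le (Nat.succ_pos k) hf0 i x).2
    simp only [hgdef]
    linarith
  have hmom : ∀ S : Finset (Fin n),
      Tendsto (fun k => ∫ x, (∏ i ∈ S, g k i) x ∂μ) atTop (𝓝 (∫ x, (∏ i ∈ S, f i) x ∂μ)) := by
    intro S
    simp only [Finset.prod_apply]
    refine tendsto_integral_of_dominated_convergence (fun _ => |B| ^ S.card)
      (fun k => (Finset.measurable_prod S fun i _ => hgm k i).aestronglyMeasurable)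
      (integrable_const _) (fun k => Eventually.of_forall fun x => ?_) (Eventually.of_forall fun x => ?_)
    · rw [Real.norm_eq_abs, abs_of_nonneg (prod_nonneg fun i _ => hg0 k i x)]
      calc ∏ i ∈ S, g k i x ≤ ∏ i ∈ S, |B| :=
            prod_le_prod (fun i _ => hg0 k i x) fun i _ => (hgle k i x).trans ((hfB i x).trans (le_abs_self B))
        _ = |B| ^ S.card := prod_const _
    · exact tendsto_finsetProd S fun i _ => hglim i x
  -- Step 3: continuity of the moment polynomial
  have hlim : Tendsto (fun k => msahiE μ n (g k)) atTop (𝓝 (msahiE μ n f)) := by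
    simp only [msahiE_eq_momentE]
    exact ((continuous_momentE n).tendsto _).comp (tendsto_pi_nhds.2 hmom)
  exact ge_of_tendsto' hlim hpos

/-- **Every probability measure on `[0,1]` is Sahi-positive of every order** (monotone functions on `[0,1]` are
Borel and bounded). [this work] -/
theorem mSahiPositive_of_probabilityMeasure_unitInterval (μ : Measure I) [IsProbabilityMeasure μ] (n : ℕ) :
    MSahiPositive μ n := by
  intro f hf0 hmono
  refine msahiE_nonneg_of_linearOrder μ n f (fun i => (hmono i).measurable) hf0 (B := ∑ i, f i 1)
    (fun i x => ?_) hmono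
  have hx1 : x ≤ 1 := Subtype.coe_le_coe.1 (by rw [Set.Icc.coe_one]; exact x.2.2)
  exact (hmono i hx1).trans (Finset.single_le_sum (f := fun j => f j 1) (fun j _ => hf0 j 1) (mem_univ i))

/-- **Every probability measure on `ℝ`**: `E_n(f_0,…,f_{n−1}) ≥ 0` for all nonnegative, bounded, monotone
`f_i : ℝ → ℝ` (measurability is automatic). [this work] -/
theorem msahiE_nonneg_of_probabilityMeasure_real (μ : Measure ℝ) [IsProbabilityMeasure μ] (n : ℕ)
    (f : Fin n → ℝ → ℝ) (hf0 : ∀ i x, 0 ≤ f i x) {B : ℝ} (hfB : ∀ i x, f i x ≤ B)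
    (hmono : ∀ i, Monotone (f i)) : 0 ≤ msahiE μ n f :=
  msahiE_nonneg_of_linearOrder μ n f (fun i => (hmono i).measurable) hf0 hfB hmono

end Summit.CriticalPhenomena.PercolationContinuityZ3.Theorems.SahiLinearOrderMeasure
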